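import Summits.Ventures.WeilGRH.DualTrigKernelLatticeFastDefs
import Summits.Ventures.WeilGRH.DualTrigKernelLatticeSoundB
import HarnessLib

/-!
# Format D-K v3.2 (multi-lattice): soundness of the fast cell checker — the product-form remainder

Cell `rh-explicit`, WEIL TRACK — GRH ARM, route B (weil-grh-3).  `rem_le_remTermX` / `rem_le_remTermP`: the interval
`remTermP etaI t` contains a number `≥ rt.rem η R` (the Taylor remainder bound of one represented term, powers of
`|κ| η⁺` through `powList`); `remSum_le_remBlockP[_hi]`: the block sum; `mem_etaI`.  Everything here is PROVED; no named
facts, no `sorry`, no kernel evaluation.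
-/

noncomputable section

open Finset Real Complex

namespace Summit.Ventures.WeilGRH

open Literature.Analysis.ValidatedNumerics.NumericsMP
open Literature.NumberTheory.LFunctions
open DualTrigTaylor DigammaVertical

namespace DKCert3

variable {c : DKCert3}

/-! ### Soundness of the product-form remainder -/

/-- One term: `rem ≤ x` for a member `x` of `remTermX xp t`, if `xp` encloses the powers of a number
`≥ |κ| η`. [folklore] -/
theorem rem_le_remTermX (hS : 0 < c.base.S) {t : DKCert.GTerm} {rt : RTerm} (h : DKCert.GRepr c.base.S c.base.R t rt)
    {η : ℝ} (hη : 0 ≤ η) {y : ℝ} (hy : |rt.κ| * η ≤ y) {xp : List MI}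
    (hxp : ∀ m ≤ 2 * c.base.R + 1, MI.mem c.base.S (y ^ m) (xp.getD m DKCert.dft)) :
    ∃ x : ℝ, rt.rem η c.base.R ≤ x ∧ MI.mem c.base.S x (c.remTermX xp t) := by
  have hSr : (0 : ℝ) < c.base.S := by exact_mod_cast hS
  set a' : ℝ := (t.A.absHi : ℝ) / c.base.S + (t.B.absHi : ℝ) / c.base.S
  have hA : |rt.A| ≤ (t.A.absHi : ℝ) / c.base.S := DKCert.abs_le_absUp hS h.memA
  have hB : |rt.B| ≤ (t.B.absHi : ℝ) / c.base.S := DKCert.abs_le_absUp hS h.memB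
  set x : ℝ := a' * (y ^ (2 * c.base.R) / ((2 * c.base.R).factorial : ℕ)) +
    a' * (y ^ (2 * c.base.R + 1) / ((2 * c.base.R + 1).factorial : ℕ)) with hxdef
  have hmem : MI.mem c.base.S x (c.remTermX xp t) := by
    unfold remTermX
    have ha' : MI.mem c.base.S a' ((DKCert.absUp t.A).add (DKCert.absUp t.B)) :=
      MI.mem_add (DKCert.mem_absUp hS _) (DKCert.mem_absUp hS _)
    refine MI.mem_add (MI.mem_mul hS ha' ?_) (MI.mem_mul hS ha' ?_)
    · exact MI.mem_divNat (hxp _ (by omega)) (Nat.factorial_pos _)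
    · exact MI.mem_divNat (hxp _ le_rfl) (Nat.factorial_pos _)
  refine ⟨x, ?_, hmem⟩
  unfold RTerm.rem
  have ha'0 : |rt.A| + |rt.B| ≤ a' := add_le_add hA hB
  have hpos : 0 ≤ |rt.A| + |rt.B| := by positivity
  have hκη0 : 0 ≤ |rt.κ| * η := by positivity
  have hy0 : 0 ≤ y := hκη0.trans hy
  have e1 : (|rt.κ| * η) ^ (2 * c.base.R) / ((2 * c.base.R).factorial : ℝ) ≤
      y ^ (2 * c.base.R) / ((2 * c.base.R).factorial : ℕ) := by
    gcongr
  have e2 : (|rt.κ| * η) ^ (2 * c.base.R + 1) / ((2 * c.base.R + 1).factorial : ℝ) ≤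
      y ^ (2 * c.base.R + 1) / ((2 * c.base.R + 1).factorial : ℕ) := by
    gcongr
  have hq1 : 0 ≤ y ^ (2 * c.base.R) / ((2 * c.base.R).factorial : ℕ) := by positivity
  have hq2 : 0 ≤ y ^ (2 * c.base.R + 1) / ((2 * c.base.R + 1).factorial : ℕ) := by positivity
  calc (|rt.A| + |rt.B|) * ((|rt.κ| * η) ^ (2 * c.base.R) / ((2 * c.base.R).factorial : ℝ) +
        (|rt.κ| * η) ^ (2 * c.base.R + 1) / ((2 * c.base.R + 1).factorial : ℝ))
      ≤ (|rt.A| + |rt.B|) * (y ^ (2 * c.base.R) / ((2 * c.base.R).factorial : ℕ) +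
          y ^ (2 * c.base.R + 1) / ((2 * c.base.R + 1).factorial : ℕ)) :=
        mul_le_mul_of_nonneg_left (add_le_add e1 e2) hpos
    _ ≤ a' * (y ^ (2 * c.base.R) / ((2 * c.base.R).factorial : ℕ) +
          y ^ (2 * c.base.R + 1) / ((2 * c.base.R + 1).factorial : ℕ)) :=
        mul_le_mul_of_nonneg_right ha'0 (add_nonneg hq1 hq2)
    _ = x := by rw [hxdef]; ring

/-- One term: `rem ≤ x` for a member `x` of `remTermP`. [folklore] -/
theorem rem_le_remTermP (hS : 0 < c.base.S) {t : DKCert.GTerm} {rt : RTerm} (h : DKCert.GRepr c.base.S c.base.R t rt)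
    {η : ℝ} (hη : 0 ≤ η) {etaI : MI} (hηm : MI.mem c.base.S η etaI) :
    ∃ x : ℝ, rt.rem η c.base.R ≤ x ∧ MI.mem c.base.S x (c.remTermP etaI t) := by
  have hκ : |rt.κ| ≤ (t.rI.absHi : ℝ) / c.base.S := DKCert.abs_le_absUp hS h.memK
  have hx : MI.mem c.base.S ((t.rI.absHi : ℝ) / c.base.S * η) (MI.mul c.base.S (DKCert.absUp t.rI) etaI) :=
    MI.mem_mul hS (DKCert.mem_absUp hS _) hηm
  have hp := (DKCert.powList_spec hS hx (2 * c.base.R + 1)).2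
  unfold remTermP
  exact rem_le_remTermX hS h hη (mul_le_mul_of_nonneg_right hκ hη) hp

/-- **The product-form block remainder**: `remSum rts η R ≤ x ∈ remBlockP`. [folklore] -/
theorem remSum_le_remBlockP (hS : 0 < c.base.S) {η : ℝ} (hη : 0 ≤ η) {etaI : MI} (hηm : MI.mem c.base.S η etaI) :
    ∀ {ts : List DKCert.GTerm} {rts : List RTerm}, List.Forall₂ (DKCert.GRepr c.base.S c.base.R) ts rts →
      ∃ x : ℝ, remSum rts η c.base.R ≤ x ∧ MI.mem c.base.S x (c.remBlockP etaI ts) := by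
  intro ts rts hF
  induction hF with
  | nil => exact ⟨0, by simp, by simpa [remBlockP] using MI.mem_ofInt c.base.S 0⟩
  | @cons t rt ts rts hh hF ih =>
      obtain ⟨x, hx, hmx⟩ := ih
      obtain ⟨y, hy, hmy⟩ := rem_le_remTermP hS hh hη hηm
      refine ⟨y + x, ?_, ?_⟩
      · rw [remSum_cons]; exact add_le_add hy hx
      · simp only [remBlockP, List.map_cons, List.foldr_cons]
        exact MI.mem_add hmy (by simpa [remBlockP] using hmx)

/-- Corollary: `remSum rts η R ≤ remBlockP.hi / S`. [folklore] -/
theorem remSum_le_remBlockP_hi (hS : 0 < c.base.S) {η : ℝ} (hη : 0 ≤ η) {etaI : MI} (hηm : MI.mem c.base.S η etaI)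
    {ts : List DKCert.GTerm} {rts : List RTerm} (hF : List.Forall₂ (DKCert.GRepr c.base.S c.base.R) ts rts) :
    remSum rts η c.base.R ≤ ((c.remBlockP etaI ts).hi : ℝ) / c.base.S := by
  obtain ⟨x, hx, hmx⟩ := remSum_le_remBlockP hS hη hηm hF
  exact hx.trans (DKCert.le_hi hS hmx)

/-- `η⁺ ∈ etaI`. [folklore] -/
theorem mem_etaI (b : DKBlock) (hden : 1 ≤ b.etaDen) : MI.mem c.base.S ((b.etaNum : ℝ) / b.etaDen) (c.etaI b) := by
  have := MI.mem_ofFrac c.base.S (b.etaNum : ℤ) (q := b.etaDen) (by omega)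
  unfold etaI
  convert this using 2; norm_cast

end DKCert3

end Summit.Ventures.WeilGRH

end
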